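import Mathlib

/-!
# Solo-blind kernel #269 — the resolvent read-out: holomorphy and envelope from LEMMA-P data

The [A′] assembly (kernels #266/#267) consumes a function `F` that is HOLOMORPHIC on a right
half-plane `{Re s > a}` and obeys a STRIP ENVELOPE `‖F(σ+iy)‖ ≤ C/√(1+y²)`.  In the programme
`F` is the resolvent read-out of the linearised streak/roll chain,
`R(s) = ℓ((1 − L(s))⁻¹ · src(s))` (ENGINE-L-SPEC §13(g), §15(n),(o)), and LEMMA P is the statement
that `1 − L(s)` is invertible with a certified bound at every point of the region (boxes + ENGINE O +
the uniform outer lemma).  This kernel is the glue between the two: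

* `readout`, `differentiableOn_readout` — if `L, src` are holomorphic on an open set `U` with values
  in a complete normed algebra and `1 − L s` is a unit for every `s ∈ U`, the read-out is holomorphic
  on `U` (Mathlib's `differentiableAt_inverse`);
* `isUnit_of_norm_lt_one`, `norm_inverse_one_sub_le` — the Neumann certificate: `‖L s‖ ≤ q < 1`
  gives the unit and `‖(1 − L s)⁻¹‖ ≤ (1 − q)⁻¹` (the `plain` verdict of the engines);
* `norm_readout_le` — `‖R s‖ ≤ ‖ℓ‖ · B · ‖src s‖` from `‖(1 − L s)⁻¹‖ ≤ B`;
* `strip_envelope` — pointwise resolvent bounds `B` and a source envelope `C₀/√(1+y²)` on the lines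
  `σ + iy`, `a < σ ≤ b`, give exactly the hypothesis `hC` of `HardyFromDecay.hardy_of_strip_decay`
  with `C = ‖ℓ‖ B C₀`.
-/

namespace Summit.AnomalousDissipation.SoloBlind.ResolventReadout

open Complex

variable {A : Type*} [NormedRing A]

section Readout
variable [NormedAlgebra ℂ A]

/-- The resolvent read-out `R(s) = ℓ ((1 − L s)⁻¹ * src s)` (`Ring.inverse`, total). -/
noncomputable def readout (L src : ℂ → A) (ℓ : A →L[ℂ] ℂ) (s : ℂ) : ℂ :=
  ℓ (Ring.inverse (1 - L s) * src s)

/-- **Holomorphy of the read-out** on an open set where `L, src` are holomorphic and `1 − L s` is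
invertible (analytic-Fredholm glue, invertibility supplied pointwise by LEMMA P). -/
theorem differentiableOn_readout [CompleteSpace A] {L src : ℂ → A} (ℓ : A →L[ℂ] ℂ) {U : Set ℂ}
    (hL : DifferentiableOn ℂ L U) (hsrc : DifferentiableOn ℂ src U)
    (hunit : ∀ s ∈ U, IsUnit (1 - L s)) : DifferentiableOn ℂ (readout L src ℓ) U := by
  intro s hs
  have h1 : DifferentiableWithinAt ℂ (fun z => (1 : A) - L z) U s :=
    (differentiableWithinAt_const _).sub (hL s hs)
  have h2 : DifferentiableWithinAt ℂ (fun z => Ring.inverse ((1 : A) - L z)) U s :=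
    h1.inverse (hunit s hs)
  have h3 : DifferentiableWithinAt ℂ (fun z => Ring.inverse ((1 : A) - L z) * src z) U s :=
    h2.mul (hsrc s hs)
  exact ℓ.differentiableAt.comp_differentiableWithinAt s h3

end Readout

section Neumann
variable [CompleteSpace A]

/-- **Neumann certificate, unit part**: `‖L s‖ < 1 ⇒ 1 − L s` is a unit. -/
theorem isUnit_of_norm_lt_one {T : A} (h : ‖T‖ < 1) : IsUnit (1 - T) :=
  ⟨Units.oneSub T h, rfl⟩

/-- **Neumann certificate, bound part**: `‖L s‖ ≤ q < 1 ⇒ ‖(1 − L s)⁻¹‖ ≤ (1 − q)⁻¹`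
(`plain` verdict; Neumann series, `tsum_geometric_le_of_norm_lt_one`). -/
theorem norm_inverse_one_sub_le [NormOneClass A] {T : A} {q : ℝ} (hT : ‖T‖ ≤ q) (hq : q < 1) :
    ‖Ring.inverse (1 - T)‖ ≤ (1 - q)⁻¹ := by
  have h : ‖T‖ < 1 := lt_of_le_of_lt hT hq
  rw [NormedRing.inverse_one_sub T h]
  have h1 : ‖(↑(Units.oneSub T h)⁻¹ : A)‖ ≤ (1 - ‖T‖)⁻¹ := by
    have := tsum_geometric_le_of_norm_lt_one T h
    rw [norm_one, sub_self, zero_add] at this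
    exact this
  exact h1.trans (inv_anti₀ (by linarith) (by linarith))

end Neumann

section Envelope
variable [NormedAlgebra ℂ A]

/-- **Read-out bound** from a resolvent bound: `‖(1 − L s)⁻¹‖ ≤ B ⇒ ‖R s‖ ≤ ‖ℓ‖ B ‖src s‖`. -/
theorem norm_readout_le {L src : ℂ → A} (ℓ : A →L[ℂ] ℂ) {s : ℂ} {B : ℝ}
    (hB : ‖Ring.inverse (1 - L s)‖ ≤ B) : ‖readout L src ℓ s‖ ≤ ‖ℓ‖ * B * ‖src s‖ := by
  unfold readout
  calc ‖ℓ (Ring.inverse (1 - L s) * src s)‖ ≤ ‖ℓ‖ * ‖Ring.inverse (1 - L s) * src s‖ :=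
        ℓ.le_opNorm _
    _ ≤ ‖ℓ‖ * (‖Ring.inverse (1 - L s)‖ * ‖src s‖) := by gcongr; exact norm_mul_le _ _
    _ ≤ ‖ℓ‖ * (B * ‖src s‖) := by gcongr
    _ = ‖ℓ‖ * B * ‖src s‖ := by ring

/-- **Strip envelope** (hypothesis `hC` of `HardyFromDecay.hardy_of_strip_decay`): a uniform
resolvent bound `B` and a source envelope `C₀/√(1+y²)` on the lines `σ + iy`, `a < σ ≤ b`, give
`‖R(σ+iy)‖ ≤ C/√(1+y²)` with `C = ‖ℓ‖ B C₀`. -/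
theorem strip_envelope {L src : ℂ → A} (ℓ : A →L[ℂ] ℂ) {a b B C₀ : ℝ} (hB0 : 0 ≤ B)
    (hB : ∀ σ y : ℝ, a < σ → σ ≤ b → ‖Ring.inverse (1 - L (σ + y * I))‖ ≤ B)
    (hsrc : ∀ σ y : ℝ, a < σ → σ ≤ b → ‖src (σ + y * I)‖ ≤ C₀ / Real.sqrt (1 + y ^ 2)) :
    ∀ σ y : ℝ, a < σ → σ ≤ b →
      ‖readout L src ℓ (σ + y * I)‖ ≤ (‖ℓ‖ * B * C₀) / Real.sqrt (1 + y ^ 2) := by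
  intro σ y hσa hσb
  have h1 := norm_readout_le (src := src) ℓ (hB σ y hσa hσb)
  have h2 := hsrc σ y hσa hσb
  have hpos : 0 < Real.sqrt (1 + y ^ 2) := Real.sqrt_pos.mpr (by positivity)
  calc ‖readout L src ℓ (σ + y * I)‖ ≤ ‖ℓ‖ * B * ‖src (σ + y * I)‖ := h1
    _ ≤ ‖ℓ‖ * B * (C₀ / Real.sqrt (1 + y ^ 2)) := by gcongr
    _ = ‖ℓ‖ * B * C₀ / Real.sqrt (1 + y ^ 2) := by ring

end Envelope

section Plain
variable [CompleteSpace A]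

/-- **Pointwise-to-strip packaging**: the engines certify, box by box, `‖L s‖ ≤ q < 1` (plain
verdict) on a cover of the closed strip; this turns a uniform `q` into the uniform resolvent bound
used by `strip_envelope` and the units used by `differentiableOn_readout`. -/
theorem strip_data_of_plain [NormOneClass A] {L : ℂ → A} {a b q : ℝ} (hq : q < 1)
    (hplain : ∀ σ y : ℝ, a < σ → σ ≤ b → ‖L (σ + y * I)‖ ≤ q) :
    (∀ σ y : ℝ, a < σ → σ ≤ b → IsUnit (1 - L (σ + y * I))) ∧
    (∀ σ y : ℝ, a < σ → σ ≤ b → ‖Ring.inverse (1 - L (σ + y * I))‖ ≤ (1 - q)⁻¹) :=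
  ⟨fun σ y h1 h2 => isUnit_of_norm_lt_one (lt_of_le_of_lt (hplain σ y h1 h2) hq),
   fun σ y h1 h2 => norm_inverse_one_sub_le (hplain σ y h1 h2) hq⟩

end Plain

end Summit.AnomalousDissipation.SoloBlind.ResolventReadout
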